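import Summits.Ventures.PercRepro.ProfilePointedCircuitClassesStarSharpS

/-!
# PercRepro — THE SERIES REGIME `{e, f}` OF `StarNineSharp`: WHEN `e` AND `f` ARE IN SERIES IN `N ∖ {b, b′}` THE
`b′`-AVOIDING TWO-POINT INEQUALITY HOLDS (p5, gen 53; `proofs/P5-GM1.md` §80 ADD 4 case A-ser, Sharp layer; StarSharpS
with the series twin `z := e`).  For (★)₇ the case is an identity (the swap `e ↔ f`), which does not preserve ON/OFF; here
every ON demand `π + e + b` (`π ⊆ H₀ := E₇ − e − f`) goes to `π + f + b` when that set is ON and to `π + e + f` otherwise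
(the cut lemma shows `(H₀ − π) ∪ {b, b′}` then has rank `5`, so `π + e + f` is bi-independent); the OFF demands go to
their complements.  **`inCount_thru_le_of_series_ef`** (13,264 catalogue configurations).  Two complement lemmas of
StarSharpT are re-proved under primed names (this module depends on the StarSharpS olean only).
-/

open scoped Matroid

namespace PercRepro.Cogirth

open Finset ThmH Skew Shadow Profile

variable {α : Type} [DecidableEq α] {N : Matroid α} [N.Finite]

section StarSharpV

variable {b b' : α}

/-- A bi-independent `4`-set inside `E₇` is OFF: `(E ∖ W) − b′ = (E₇ ∖ W) + b` is bi-independent (copy of StarSharpT). -/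
theorem compl_erase_mem_of_subset_E7' (h : SeriesPair N b b') (hn : (gr N).card = 9) {W : Finset α}
    (hW : W ∈ biIndepSets N 4) (hbW : b ∉ W) (hb'W : b' ∉ W) : (gr N \ W).erase b' ∈ biIndepSets N 4 := by
  have hb : b ∈ gr N := h.1; have hb' : b' ∈ gr N := h.2.1; have hbb' : b ≠ b' := h.2.2.1
  obtain ⟨hWg, hW4, -, -⟩ := mem_biIndepSets.1 hW
  have hWE : W ⊆ ((gr N).erase b).erase b' := fun x hx =>
    mem_erase.2 ⟨fun h' => hb'W (h' ▸ hx), mem_erase.2 ⟨fun h' => hbW (h' ▸ hx), hWg hx⟩⟩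
  obtain ⟨hWr, hWc⟩ := (mem_biIndepSets_iff_of_subset_E7 h hn hWE hW4).1 hW
  have hE7 : (((gr N).erase b).erase b').card = 7 := by
    rw [card_erase_of_mem (mem_erase.2 ⟨hbb'.symm, hb'⟩), card_erase_of_mem hb, hn]
  have hYc : (((gr N).erase b).erase b' \ W).card = 3 := by rw [card_sdiff_of_subset hWE, hE7, hW4]
  have hYE : ((gr N).erase b).erase b' \ W ⊆ ((gr N).erase b).erase b' := sdiff_subset
  have e1 : (gr N \ W).erase b' = insert b (((gr N).erase b).erase b' \ W) := by
    ext x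
    simp only [mem_erase, mem_sdiff, mem_insert]
    constructor
    · rintro ⟨hxb', hxg, hxW⟩
      by_cases hxb : x = b
      · exact Or.inl hxb
      · exact Or.inr ⟨⟨hxb', hxb, hxg⟩, hxW⟩
    · rintro (rfl | ⟨⟨hxb', hxb, hxg⟩, hxW⟩)
      · exact ⟨hbb', hb, hbW⟩
      · exact ⟨hxb', hxg, hxW⟩
  rw [e1, insert_b_mem_biIndepSets_iff h hn hYE hYc, Finset.sdiff_sdiff_eq_self hWE, hWr]
  refine ⟨?_, rfl⟩
  have h1 := rk_insert_le_add_one hb' (insert_subset hb (hYE.trans ((erase_subset _ _).trans (erase_subset _ _))))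
  have e2 : insert b' (insert b (((gr N).erase b).erase b' \ W)) = insert b (insert b' (((gr N).erase b).erase b' \ W)) := by
    ext x; simp only [mem_insert]; tauto
  rw [e2, hWc, rk_insert_left_eq_add_one_of_seriesPair h hYE] at h1
  have h2 := rk_le_card' (M := N) (((gr N).erase b).erase b' \ W)
  rw [hYc] at h2
  omega

/-- The complement map is an involution on the sets avoiding `b′` (copy of StarSharpT). -/
theorem compl_erase_erase' {W : Finset α} (hW : W ∈ biIndepSets N 4) (hb'W : b' ∉ W) :
    (gr N \ (gr N \ W).erase b').erase b' = W := by
  have hWg : W ⊆ gr N := (mem_biIndepSets.1 hW).1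
  ext x
  simp only [mem_erase, mem_sdiff]
  constructor
  · rintro ⟨hxb', hxg, hx⟩
    by_contra hxW
    exact hx ⟨hxb', hxg, hxW⟩
  · intro hxW
    exact ⟨fun h' => hb'W (h' ▸ hxW), hWg hxW, fun h' => h'.2.2 hxW⟩

/-- For `π ⊆ H₀` with `(π + e) + b ∈ BI_4(N)` and `π + e` ON: `(π + f) + b ∈ BI_4(N)`, and it is ON or `π ∪ {e, f} ∈ BI_4(N)`. -/
theorem images_of_series_ef (h : SeriesPair N b b') (hn : (gr N).card = 9) (hR : rk N (gr N) = 5)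
    (hcf : ∀ x ∈ gr N, rk N ((gr N).erase x) = 5) {e f : α} (he : e ∈ gr N) (hf : f ∈ gr N) (hef : e ≠ f)
    (heb : e ≠ b) (heb' : e ≠ b') (hfb : f ≠ b) (hfb' : f ≠ b')
    (hH : rk N (((((gr N).erase b).erase b').erase f).erase e) = 3)
    (hf' : rk N ((((gr N).erase b).erase b').erase f) = 4) (he' : rk N ((((gr N).erase b).erase b').erase e) = 4)
    {π : Finset α} (hπ : π ⊆ ((((gr N).erase b).erase b').erase f).erase e) (hπ2 : π.card = 2)
    (hW : insert b (insert e π) ∈ biIndepSets N 4) (hYon : rk N (insert b (insert b' (insert e π))) = 4) :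
    insert b (insert f π) ∈ biIndepSets N 4 ∧
      (rk N (insert b (insert b' (insert f π))) = 4 ∨ insert f (insert e π) ∈ biIndepSets N 4) := by
  have hb : b ∈ gr N := h.1; have hb' : b' ∈ gr N := h.2.1; have hbb' : b ≠ b' := h.2.2.1
  set H := ((((gr N).erase b).erase b').erase f).erase e with hHdef
  have hHE : H ⊆ ((gr N).erase b).erase b' := (erase_subset _ _).trans (erase_subset _ _)
  have hπE : π ⊆ ((gr N).erase b).erase b' := hπ.trans hHE
  have heE : e ∈ ((gr N).erase b).erase b' := mem_erase.2 ⟨heb', mem_erase.2 ⟨heb, he⟩⟩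
  have hfE : f ∈ ((gr N).erase b).erase b' := mem_erase.2 ⟨hfb', mem_erase.2 ⟨hfb, hf⟩⟩
  have heπ : e ∉ π := fun h' => (mem_erase.1 (hπ h')).1 rfl
  have hfπ : f ∉ π := fun h' => (mem_erase.1 (mem_erase.1 (hπ h')).2).1 rfl
  have hYE : insert e π ⊆ ((gr N).erase b).erase b' := insert_subset heE hπE
  have hY3 : (insert e π).card = 3 := by rw [card_insert_of_notMem heπ, hπ2]
  obtain ⟨hYr, hYc⟩ := (insert_b_mem_biIndepSets_iff h hn hYE hY3).1 hW
  have hE7 : (((gr N).erase b).erase b').card = 7 := by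
    rw [card_erase_of_mem (mem_erase.2 ⟨hbb'.symm, hb'⟩), card_erase_of_mem hb, hn]
  have hHc : H.card = 5 := by
    rw [hHdef, card_erase_of_mem (show e ∈ (((gr N).erase b).erase b').erase f from mem_erase.2 ⟨hef, heE⟩),
      card_erase_of_mem hfE, hE7]
  have hcompl : ((gr N).erase b).erase b' \ insert e π = insert f (H \ π) := by
    ext x
    simp only [mem_sdiff, mem_insert, hHdef, mem_erase, not_or]
    constructor
    · rintro ⟨⟨hxb', hxb, hxg⟩, hxe, hxπ⟩
      by_cases hxf : x = f
      · exact Or.inl hxf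
      · exact Or.inr ⟨⟨hxe, hxf, hxb', hxb, hxg⟩, hxπ⟩
    · rintro (rfl | ⟨⟨hxe, hxf, hxb', hxb, hxg⟩, hxπ⟩)
      · exact ⟨⟨hfb', hfb, hf⟩, hef.symm, hfπ⟩
      · exact ⟨⟨hxb', hxb, hxg⟩, hxe, hxπ⟩
  have hHπ : H \ π ⊆ H := sdiff_subset
  have hHπc : (H \ π).card = 3 := by rw [card_sdiff_of_subset hπ, hHc, hπ2]
  have hHπr : rk N (H \ π) = 3 := by
    have h1 : rk N (((gr N).erase b).erase b' \ insert e π) = (((gr N).erase b).erase b' \ insert e π).card := by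
      rw [hYc, card_sdiff_of_subset hYE, hE7, hY3]
    rw [rk_eq_card_of_subset_of_rk_eq_card (by rw [hcompl]; exact subset_insert _ _) h1, hHπc]
  have hπr : rk N π = 2 := by
    rw [rk_eq_card_of_subset_of_rk_eq_card (subset_insert e π) (by rw [hYr, hY3]), hπ2]
  have hfπE : insert f π ⊆ ((gr N).erase b).erase b' := insert_subset hfE hπE
  have hfπ3 : (insert f π).card = 3 := by rw [card_insert_of_notMem hfπ, hπ2]
  have hcompl2 : ((gr N).erase b).erase b' \ insert f π = insert e (H \ π) := by
    ext x
    simp only [mem_sdiff, mem_insert, hHdef, mem_erase, not_or]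
    constructor
    · rintro ⟨⟨hxb', hxb, hxg⟩, hxf, hxπ⟩
      by_cases hxe : x = e
      · exact Or.inl hxe
      · exact Or.inr ⟨⟨hxe, hxf, hxb', hxb, hxg⟩, hxπ⟩
    · rintro (rfl | ⟨⟨hxe, hxf, hxb', hxb, hxg⟩, hxπ⟩)
      · exact ⟨⟨heb', heb, he⟩, hef, heπ⟩
      · exact ⟨⟨hxb', hxb, hxg⟩, hxf, hxπ⟩
  have him1 : insert b (insert f π) ∈ biIndepSets N 4 := by
    rw [insert_b_mem_biIndepSets_iff h hn hfπE hfπ3, rk_insert_f_eq_add_one_of_subset_H hf hef.symm hfb hfb' hH he' hπ, hπr,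
      hcompl2, rk_insert_z_eq_add_one_of_subset_H he hef.symm heb heb' hH hf' hHπ, hHπr]
    exact ⟨rfl, rfl⟩
  refine ⟨him1, ?_⟩
  by_cases hon : rk N (insert b (insert b' (insert f π))) = 4
  · exact Or.inl hon
  · right
    have hPz : rk N (insert b (insert b' (H \ π))) = 5 := by
      by_contra hne
      have h5 : rk N (insert b (insert b' (H \ π))) ≤ 5 := by
        have := rk_mono' (M := N) (show insert b (insert b' (H \ π)) ⊆ gr N from
          insert_subset hb (insert_subset hb' ((hHπ.trans hHE).trans ((erase_subset _ _).trans (erase_subset _ _)))))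
        omega
      have h4 : 4 ≤ rk N (insert b (insert b' (H \ π))) := by
        have h1 : rk N (insert b (H \ π)) = 4 := by
          rw [rk_insert_left_eq_add_one_of_seriesPair h (hHπ.trans hHE), hHπr]
        rw [← h1]
        exact rk_mono' (M := N) (insert_subset_insert b (subset_insert b' _))
      have hYon' : rk N (insert b (insert b' (H \ π))) = 4 := by omega
      have hPπ : H \ (H \ π) = π := Finset.sdiff_sdiff_eq_self hπ
      have hPr : rk N (H \ (H \ π)) = 2 := by rw [hPπ]; exact hπr
      have hPz' : rk N (insert b (insert b' (insert e (H \ (H \ π))))) = 4 := by rw [hPπ]; exact hYon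
      have := cut_lemma h hcf hf he hef.symm hfb hfb' heb heb' hH he' hHπ hHπr hPr hYon' hPz'
      rw [hPπ] at this
      exact hon this
    have hfYE : insert f (insert e π) ⊆ ((gr N).erase b).erase b' := insert_subset hfE hYE
    have hfY4 : (insert f (insert e π)).card = 4 := by
      rw [card_insert_of_notMem (fun h' => (mem_insert.1 h').elim (fun h'' => hef h''.symm) hfπ), hY3]
    have e3 : ((gr N).erase b).erase b' \ insert f (insert e π) = H \ π := by
      ext x
      simp only [mem_sdiff, mem_insert, hHdef, mem_erase, not_or]
      constructor
      · rintro ⟨⟨hxb', hxb, hxg⟩, hxf, hxe, hxπ⟩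
        exact ⟨⟨hxe, hxf, hxb', hxb, hxg⟩, hxπ⟩
      · rintro ⟨⟨hxe, hxf, hxb', hxb, hxg⟩, hxπ⟩
        exact ⟨⟨hxb', hxb, hxg⟩, hxf, hxe, hxπ⟩
    have hfY : rk N (insert f (insert e π)) = 4 := by
      by_contra hne
      have hle := rk_insert_le_add_one hf (hYE.trans ((erase_subset _ _).trans (erase_subset _ _)))
      have hge : rk N (insert e π) ≤ rk N (insert f (insert e π)) := rk_mono' (M := N) (subset_insert f _)
      have hcl : f ∈ clF N (insert e π) := by
        rw [mem_clF_iff_rk_insert_eq hf (hYE.trans ((erase_subset _ _).trans (erase_subset _ _)))]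
        omega
      have hcl2 : f ∈ clF N (insert b (insert b' (insert e π))) :=
        clF_mono_sub ((subset_insert b' _).trans (subset_insert b _)) hcl
      rw [mem_clF_iff_rk_insert_eq hf (insert_subset hb (insert_subset hb'
        (hYE.trans ((erase_subset _ _).trans (erase_subset _ _))))), hYon] at hcl2
      have hsub : insert b (insert b' (insert f π)) ⊆ insert f (insert b (insert b' (insert e π))) := by
        intro x hx
        simp only [mem_insert] at hx ⊢
        tauto
      have h1 := rk_mono' (M := N) hsub
      have h2 : 4 ≤ rk N (insert b (insert b' (insert f π))) := by
        have h3 : rk N (insert b (insert f π)) = 4 := by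
          rw [rk_insert_left_eq_add_one_of_seriesPair h hfπE,
            rk_insert_f_eq_add_one_of_subset_H hf hef.symm hfb hfb' hH he' hπ, hπr]
        rw [← h3]
        exact rk_mono' (M := N) (insert_subset_insert b (subset_insert b' _))
      omega
    rw [mem_biIndepSets_iff_of_subset_E7 h hn hfYE hfY4, hfY, e3]
    exact ⟨rfl, hPz⟩

/-- **THE SERIES REGIME `{e, f}` OF `StarNineSharp`**: `e, f ∉ {b, b′}` in series in `R = N ∖ {b, b′}` ⟹ the Prop's
inequality at `(e, f)`. -/
theorem inCount_thru_le_of_series_ef (hn : (gr N).card = 9) (hR : rk N (gr N) = 5)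
    (hcf : ∀ x ∈ gr N, rk N ((gr N).erase x) = 5) (h : SeriesPair N b b') {e f : α}
    (he : e ∈ gr N) (hf : f ∈ gr N) (hef : e ≠ f) (heb : e ≠ b) (heb' : e ≠ b') (hfb : f ≠ b) (hfb' : f ≠ b')
    (hH : rk N (((((gr N).erase b).erase b').erase f).erase e) = 3)
    (hf' : rk N ((((gr N).erase b).erase b').erase f) = 4) (he' : rk N ((((gr N).erase b).erase b').erase e) = 4) :
    inCount N 4 e + thruCount N 4 {b', f} + thruCount N 4 {b', e, f} ≤
      inCount N 4 f + thruCount N 4 {e, f} + thruCount N 4 {b', e} := by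
  rw [inCount_thru_split']
  have hb : b ∈ gr N := h.1; have hb' : b' ∈ gr N := h.2.1; have hbb' : b ≠ b' := h.2.2.1
  have hHE : ((((gr N).erase b).erase b').erase f).erase e ⊆ ((gr N).erase b).erase b' :=
    (erase_subset _ _).trans (erase_subset _ _)
  have hE7c : (((gr N).erase b).erase b').card = 7 := by
    rw [card_erase_of_mem (mem_erase.2 ⟨hbb'.symm, hb'⟩), card_erase_of_mem hb, hn]
  have hsplit := card_filter_add_card_filter_not (s := (biIndepSets N 4).filter (fun W => (e ∈ W ∧ f ∉ W) ∧ b' ∉ W))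
    (fun W => (gr N \ W).erase b' ∈ biIndepSets N 4)
  simp only [filter_filter] at hsplit
  have htar : ((biIndepSets N 4).filter (fun W => (f ∈ W ∧ b' ∉ W) ∧ (e ∉ W ∧ (gr N \ W).erase b' ∈ biIndepSets N 4))).card +
      ((biIndepSets N 4).filter (fun W => (f ∈ W ∧ b' ∉ W) ∧ (e ∉ W ∧ b ∈ W ∧ ¬ (gr N \ W).erase b' ∈ biIndepSets N 4))).card +
      ((biIndepSets N 4).filter (fun W => (f ∈ W ∧ b' ∉ W) ∧ e ∈ W)).card ≤
      ((biIndepSets N 4).filter (fun W => f ∈ W ∧ b' ∉ W)).card := by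
    rw [← card_union_of_disjoint, ← card_union_of_disjoint]
    · apply card_le_card
      intro W hW
      simp only [mem_union, mem_filter] at hW ⊢
      rcases hW with (hW | hW) | hW <;> exact ⟨hW.1, hW.2.1⟩
    · rw [disjoint_union_left]
      constructor
      · rw [disjoint_filter]
        rintro W _ ⟨-, heW, -⟩ ⟨-, heW'⟩
        exact heW heW'
      · rw [disjoint_filter]
        rintro W _ ⟨-, heW, -, -⟩ ⟨-, heW'⟩
        exact heW heW'
    · rw [disjoint_filter]
      rintro W _ ⟨-, -, hcW⟩ ⟨-, -, -, hncW⟩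
      exact hncW hcW
  have hinj1 : ((biIndepSets N 4).filter (fun W => ((e ∈ W ∧ f ∉ W) ∧ b' ∉ W) ∧ (gr N \ W).erase b' ∈ biIndepSets N 4)).card ≤
      ((biIndepSets N 4).filter (fun W => (f ∈ W ∧ b' ∉ W) ∧ (e ∉ W ∧ (gr N \ W).erase b' ∈ biIndepSets N 4))).card := by
    apply card_le_card_of_injOn (fun W => (gr N \ W).erase b')
    · intro W hW
      simp only [mem_coe, mem_filter] at hW ⊢
      obtain ⟨hWs, ⟨⟨heW, hfW⟩, hb'W⟩, hcW⟩ := hW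
      refine ⟨hcW, ⟨mem_erase.2 ⟨hfb', mem_sdiff.2 ⟨hf, hfW⟩⟩, fun h' => (mem_erase.1 h').1 rfl⟩,
        fun h' => (mem_sdiff.1 (mem_of_mem_erase h')).2 heW, ?_⟩
      rw [compl_erase_erase' hWs hb'W]
      exact hWs
    · intro W₁ hW₁ W₂ hW₂ heq
      simp only [mem_coe, mem_filter] at hW₁ hW₂
      have e1 := compl_erase_erase' hW₁.1 hW₁.2.1.2
      have e2 := compl_erase_erase' hW₂.1 hW₂.2.1.2
      have heq' : (gr N \ W₁).erase b' = (gr N \ W₂).erase b' := heq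
      rw [← e1, ← e2, heq']
  have hdata : ∀ W ∈ biIndepSets N 4, ((e ∈ W ∧ f ∉ W) ∧ b' ∉ W) → ¬ (gr N \ W).erase b' ∈ biIndepSets N 4 →
      b ∈ W ∧ (W.erase b).erase e ⊆ ((((gr N).erase b).erase b').erase f).erase e ∧ ((W.erase b).erase e).card = 2 ∧
        insert b (insert e ((W.erase b).erase e)) = W ∧ rk N (insert b (insert b' (W.erase b))) = 4 := by
    intro W hWs hPD hcW
    have hbW : b ∈ W := by
      by_contra hbW
      exact hcW (compl_erase_mem_of_subset_E7' h hn hWs hbW hPD.2)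
    obtain ⟨hWg, hW4, -, -⟩ := mem_biIndepSets.1 hWs
    have heY : e ∈ W.erase b := mem_erase.2 ⟨heb, hPD.1.1⟩
    have hπH : (W.erase b).erase e ⊆ ((((gr N).erase b).erase b').erase f).erase e := by
      intro x hx
      rw [mem_erase, mem_erase] at hx
      exact mem_erase.2 ⟨hx.1, mem_erase.2 ⟨fun h' => hPD.1.2 (h' ▸ hx.2.2), mem_erase.2 ⟨fun h' => hPD.2 (h' ▸ hx.2.2),
        mem_erase.2 ⟨hx.2.1, hWg hx.2.2⟩⟩⟩⟩
    have hπ2 : ((W.erase b).erase e).card = 2 := by rw [card_erase_of_mem heY, card_erase_of_mem hbW, hW4]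
    have hWeq : insert b (insert e ((W.erase b).erase e)) = W := by rw [insert_erase heY, insert_erase hbW]
    refine ⟨hbW, hπH, hπ2, hWeq, ?_⟩
    have hYE : W.erase b ⊆ ((gr N).erase b).erase b' := by
      intro x hx
      rw [mem_erase] at hx
      exact mem_erase.2 ⟨fun h' => hPD.2 (h' ▸ hx.2), mem_erase.2 ⟨hx.1, hWg hx.2⟩⟩
    have hY3 : (W.erase b).card = 3 := by rw [card_erase_of_mem hbW, hW4]
    have hW' : insert b (W.erase b) ∈ biIndepSets N 4 := by rw [insert_erase hbW]; exact hWs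
    obtain ⟨hYr, hYc⟩ := (insert_b_mem_biIndepSets_iff h hn hYE hY3).1 hW'
    have e1 : (gr N \ W).erase b' = ((gr N).erase b).erase b' \ W.erase b := by
      ext x
      simp only [mem_erase, mem_sdiff, not_and]
      constructor
      · rintro ⟨hxb', hxg, hxW⟩
        exact ⟨⟨hxb', fun h' => hxW (h' ▸ hbW), hxg⟩, fun _ => hxW⟩
      · rintro ⟨⟨hxb', hxb, hxg⟩, hxW⟩
        exact ⟨hxb', hxg, fun h' => hxW hxb h'⟩
    have hYc' : (((gr N).erase b).erase b' \ W.erase b).card = 4 := by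
      rw [card_sdiff_of_subset hYE, hE7c, hY3]
    rw [e1, mem_biIndepSets_iff_of_subset_E7 h hn sdiff_subset hYc', Finset.sdiff_sdiff_eq_self hYE, hYc] at hcW
    have h4 : rk N (insert b (W.erase b)) = 4 := by
      rw [rk_insert_left_eq_add_one_of_seriesPair h hYE, hYr]
    have h5 : rk N (insert b (insert b' (W.erase b))) ≤ rk N (insert b (W.erase b)) + 1 := by
      have e2 : insert b (insert b' (W.erase b)) = insert b' (insert b (W.erase b)) := by
        ext x; simp only [mem_insert]; tauto
      rw [e2]
      exact rk_insert_le_add_one hb' (insert_subset hb (hYE.trans ((erase_subset _ _).trans (erase_subset _ _))))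
    have h6 : rk N (insert b (W.erase b)) ≤ rk N (insert b (insert b' (W.erase b))) :=
      rk_mono' (M := N) (insert_subset_insert b (subset_insert b' _))
    have : ¬ rk N (insert b (insert b' (W.erase b))) = 5 := fun h' => hcW ⟨rfl, h'⟩
    omega
  have hcomplF : ∀ π ⊆ ((((gr N).erase b).erase b').erase f).erase e,
      ((gr N).erase b).erase b' \ insert f π = insert e (((((gr N).erase b).erase b').erase f).erase e \ π) := by
    intro π hπ
    ext x
    simp only [mem_sdiff, mem_insert, mem_erase, not_or]
    constructor
    · rintro ⟨⟨hxb', hxb, hxg⟩, hxf, hxπ⟩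
      by_cases hxe : x = e
      · exact Or.inl hxe
      · exact Or.inr ⟨⟨hxe, hxf, hxb', hxb, hxg⟩, hxπ⟩
    · rintro (rfl | ⟨⟨hxe, hxf, hxb', hxb, hxg⟩, hxπ⟩)
      · exact ⟨⟨heb', heb, he⟩, hef, fun h' => (mem_erase.1 (hπ h')).1 rfl⟩
      · exact ⟨⟨hxb', hxb, hxg⟩, hxf, hxπ⟩
  have hinj2 : ((biIndepSets N 4).filter (fun W => ((e ∈ W ∧ f ∉ W) ∧ b' ∉ W) ∧
        ¬ (gr N \ W).erase b' ∈ biIndepSets N 4)).card ≤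
      ((biIndepSets N 4).filter (fun W => (f ∈ W ∧ b' ∉ W) ∧ (e ∉ W ∧ b ∈ W ∧ ¬ (gr N \ W).erase b' ∈ biIndepSets N 4))).card +
      ((biIndepSets N 4).filter (fun W => (f ∈ W ∧ b' ∉ W) ∧ e ∈ W)).card := by
    rw [← card_union_of_disjoint (by rw [disjoint_filter]; rintro W _ ⟨-, heW, -, -⟩ ⟨-, heW'⟩; exact heW heW')]
    apply card_le_card_of_injOn (fun W =>
      if rk N (insert b (insert b' (insert f ((W.erase b).erase e)))) = 4 then
        insert b (insert f ((W.erase b).erase e)) else insert f (W.erase b))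
    · intro W hW
      simp only [mem_coe, mem_filter] at hW
      obtain ⟨hWs, hPD, hcW⟩ := hW
      obtain ⟨hbW, hπH, hπ2, hWeq, hYon⟩ := hdata W hWs hPD hcW
      have hW' : insert b (insert e ((W.erase b).erase e)) ∈ biIndepSets N 4 := by rw [hWeq]; exact hWs
      have hYon' : rk N (insert b (insert b' (insert e ((W.erase b).erase e)))) = 4 := by
        rw [insert_erase (mem_erase.2 ⟨heb, hPD.1.1⟩)]; exact hYon
      obtain ⟨him1, hdisj⟩ := images_of_series_ef h hn hR hcf he hf hef heb heb' hfb hfb' hH hf' he' hπH hπ2 hW' hYon'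
      have heπ : e ∉ (W.erase b).erase e := fun h' => (mem_erase.1 h').1 rfl
      have hb'π : b' ∉ (W.erase b).erase e := fun h' => hPD.2 (mem_of_mem_erase (mem_of_mem_erase h'))
      simp only [mem_coe, mem_union, mem_filter]
      split_ifs with hon
      · refine Or.inl ⟨him1, ⟨mem_insert_of_mem (mem_insert_self _ _), ?_⟩, ?_, mem_insert_self _ _, ?_⟩
        · intro h'
          rcases mem_insert.1 h' with h2 | h2
          · exact hbb' h2.symm
          · rcases mem_insert.1 h2 with h3 | h3
            · exact hfb' h3.symm
            · exact hb'π h3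
        · intro h'
          rcases mem_insert.1 h' with h2 | h2
          · exact heb h2
          · rcases mem_insert.1 h2 with h3 | h3
            · exact hef h3
            · exact heπ h3
        · intro hc
          have hfπE : insert f ((W.erase b).erase e) ⊆ ((gr N).erase b).erase b' :=
            insert_subset (mem_erase.2 ⟨hfb', mem_erase.2 ⟨hfb, hf⟩⟩) (hπH.trans hHE)
          have e3 : (gr N \ insert b (insert f ((W.erase b).erase e))).erase b' =
              insert e (((((gr N).erase b).erase b').erase f).erase e \ (W.erase b).erase e) := by
            rw [sdiff_insert_b_eq hb' hbb' hfπE, erase_insert (fun h' => (mem_erase.1 (mem_sdiff.1 h').1).1 rfl),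
              hcomplF _ hπH]
          rw [e3] at hc
          have hsE : insert e (((((gr N).erase b).erase b').erase f).erase e \ (W.erase b).erase e) ⊆ ((gr N).erase b).erase b' :=
            insert_subset (mem_erase.2 ⟨heb', mem_erase.2 ⟨heb, he⟩⟩) (sdiff_subset.trans hHE)
          have hHc : (((((gr N).erase b).erase b').erase f).erase e).card = 5 := by
            rw [card_erase_of_mem (show e ∈ (((gr N).erase b).erase b').erase f from
              mem_erase.2 ⟨hef, mem_erase.2 ⟨heb', mem_erase.2 ⟨heb, he⟩⟩⟩),
              card_erase_of_mem (show f ∈ ((gr N).erase b).erase b' from mem_erase.2 ⟨hfb', mem_erase.2 ⟨hfb, hf⟩⟩), hE7c]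
          have hs4 : (insert e (((((gr N).erase b).erase b').erase f).erase e \ (W.erase b).erase e)).card = 4 := by
            rw [card_insert_of_notMem (fun h' => (mem_erase.1 (mem_sdiff.1 h').1).1 rfl), card_sdiff_of_subset hπH, hHc, hπ2]
          have e4 : ((gr N).erase b).erase b' \ insert e (((((gr N).erase b).erase b').erase f).erase e \ (W.erase b).erase e) =
              insert f ((W.erase b).erase e) := by
            rw [← hcomplF _ hπH, Finset.sdiff_sdiff_eq_self hfπE]
          rw [mem_biIndepSets_iff_of_subset_E7 h hn hsE hs4, e4] at hc
          omega
      · rcases hdisj with h4 | him2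
        · exact absurd h4 hon
        · rw [insert_erase (mem_erase.2 ⟨heb, hPD.1.1⟩)] at him2
          exact Or.inr ⟨him2, ⟨mem_insert_self _ _, fun h' => (mem_insert.1 h').elim (fun h2 => hfb' h2.symm)
            (fun h2 => hPD.2 (mem_of_mem_erase h2))⟩, mem_insert_of_mem (mem_erase.2 ⟨heb, hPD.1.1⟩)⟩
    · intro W₁ hW₁ W₂ hW₂ heq
      simp only [mem_coe, mem_filter] at hW₁ hW₂
      obtain ⟨hb₁, hπ₁, -, hWeq₁, -⟩ := hdata W₁ hW₁.1 hW₁.2.1 hW₁.2.2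
      obtain ⟨hb₂, hπ₂, -, hWeq₂, -⟩ := hdata W₂ hW₂.1 hW₂.2.1 hW₂.2.2
      have hf₁ : f ∉ W₁.erase b := fun h' => hW₁.2.1.1.2 (mem_of_mem_erase h')
      have hf₂ : f ∉ W₂.erase b := fun h' => hW₂.2.1.1.2 (mem_of_mem_erase h')
      have hfπ₁ : f ∉ (W₁.erase b).erase e := fun h' => hf₁ (mem_of_mem_erase h')
      have hfπ₂ : f ∉ (W₂.erase b).erase e := fun h' => hf₂ (mem_of_mem_erase h')
      have hbY : ∀ Y : Finset α, b ∉ insert f (Y.erase b) := fun Y h' =>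
        (mem_insert.1 h').elim (fun h2 => hfb h2.symm) (fun h2 => (mem_erase.1 h2).1 rfl)
      simp only at heq
      split_ifs at heq with h₁ h₂ h₂
      · have hbπ : ∀ Y : Finset α, b ∉ insert f ((Y.erase b).erase e) := fun Y h' =>
          (mem_insert.1 h').elim (fun h2 => hfb h2.symm) (fun h2 => (mem_erase.1 (mem_of_mem_erase h2)).1 rfl)
        have e1 : (W₁.erase b).erase e = (W₂.erase b).erase e := by
          have h1 : insert f ((W₁.erase b).erase e) = insert f ((W₂.erase b).erase e) := by
            have := congrArg (fun S => S.erase b) heq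
            simp only [erase_insert (hbπ _)] at this
            exact this
          rw [← erase_insert hfπ₁, ← erase_insert hfπ₂, h1]
        rw [← hWeq₁, ← hWeq₂, e1]
      · exact absurd (heq ▸ mem_insert_self b _) (hbY _)
      · exact absurd (heq.symm ▸ mem_insert_self b _) (hbY _)
      · have e2 : W₁.erase b = W₂.erase b := by
          rw [← erase_insert hf₁, ← erase_insert hf₂, heq]
        rw [← insert_erase hb₁, ← insert_erase hb₂, e2]
  omega

end StarSharpV

end PercRepro.Cogirth
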